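import Literature.AnabelianGeometry.SemiGraphs.TemperedFreeTwoSlim
import HarnessLib

/-!
# The tempered model group `Γ = F̂₃ ×_{Ẑ} ℤ` is SLIM — [SemiAnbd] Ex. 3.10 "temp-slim", rank-three model

Mochizuki, *Semi-graphs of anabelioids*, Publ. RIMS **42** (2006) [SemiAnbd], Example 3.10 p. 45
("we thus conclude that both `Δ` and `Π` are temp-slim"), §0 / [FrdI] §0 p. 13 ("slim": every open
subgroup has trivial centraliser).  abc-iut cell, seat abc-iut-L4-t13 (gen 7); the rank-THREE twin of
abc-iut-w5-d218's `TemperedFreeTwoSlim.lean` (part C of the fibre-product toolkit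
`TemperedFibreProduct*.lean`, whose parts A–B are already generic in the profinite group `P`).  Needed
by the cell's NON-COMPACT tempered models with a cusp whose de-cuspidalization keeps a NONABELIAN (hence
possibly slim) geometric group: killing one free generator of `F̂₃` leaves `F̂₂` (killing one of `F̂₂`
leaves the abelian `Ẑ`).  PROOF-ONLY, hypothesis-parametrised (no definition, no instance, no named
fact).

SETTING. `F₃ = FreeGroup (Fin 3)` with free generators `a = of 0`, `b = of 1` (and `c = of 2`); `F̂₃`,
`Ẑ` the profinite completions (`profiniteCompletion`, `toCompletion = η`, `ι`); a character
`σ : F₃ → ℤ` KILLING `a` AND `b` (in the model: the exponent sum of `c`) with completion `e : F̂₃ → Ẑ`,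
defining the fibre product `Γ ≤ F̂₃ × ℤ`, `(x, n) ∈ Γ ↔ e x = ι n`; the exponent sums `σa`, `σb` of
`a`, `b` with completions `êa`, `êb`, and `îa`, `îb : Ẑ → F̂₃` completing `k ↦ a^k`, `k ↦ b^k`.
RESULT `centralizer_eq_bot_of_isOpen₃` (= the field of `IsSlimGroup Γ`; use `⟨centralizer_eq_bot_of_isOpen₃ …⟩`):
**`Γ` is slim** — verbatim the rank-two argument: an open `U ≤ Γ` contains a
slice `(V × 0) ∩ Γ` (part A), hence `(η b^m, 0)` and `(η(a b^m a⁻¹), 0)` for `m = [F₃ : η⁻¹V]` (both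
have `σ = 0`); a centralising `(z, n)` has `z ∈ C_{F̂₃}(η b^m) = cl η⟨b⟩ ⊆ îb(Ẑ)` (the CENTRALISER
CONDITION for free groups in their profinite completion, abc-iut-L5-d2, + Magnus–Karrass–Solitar
4.1.6), likewise `(η a)⁻¹ z (η a)`; evaluating `êb` (kills `η a`, splits `îb`) gives `z ∈ C(η a) =
cl η⟨a⟩ ⊆ îa(Ẑ)`; evaluating `êa` (splits `îa`, kills `îb(Ẑ)`) gives `z = 1`; finally `ι n = e 1 = 1`
forces `n = 0`.
HONEST FRAMING: classical combinatorial/profinite group theory; nothing of [SemiAnbd]/[EtTh] is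
asserted; no side is taken on any disputed claim.
-/

noncomputable section

open Topology Filter Set Function
open Literature.IUT.HodgeTheaters (profiniteCompletion toCompletion)
open Literature.AlgebraicGeometry.Frobenioids (IsSlimGroup)
open Literature.GroupTheory.CombinatorialGroupTheory

namespace Literature.AnabelianGeometry.SemiGraphs

namespace TemperedFibreProduct

/-! ### Centralisers of powers of free generators in `F̂₃` -/

/-- For `F = FreeGroup (Fin 3)` and `m ≠ 0`, `C_{F̂}(η (of i)^m) ⊆ closure (η ⟨of i⟩)` — the
centraliser condition `C_{F̂}(η g) = cl η C_F(g)` (conjugacy separability of free groups) with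
`C_F((of i)^m) = ⟨of i⟩` (Magnus–Karrass–Solitar 4.1.6). [cite: MagnusKarrassSolitar1966, Cor. 4.1.6] -/
theorem centralizer_eta_of_zpow_subset₃ (i : Fin 3) {m : ℤ} (hm : m ≠ 0) :
    (Subgroup.centralizer
        ({toCompletion (FreeGroup (Fin 3)) (FreeGroup.of i ^ m)} :
          Set (profiniteCompletion (FreeGroup (Fin 3)))) : Set _) ⊆
      closure (toCompletion (FreeGroup (Fin 3)) ''
        (Subgroup.zpowers (FreeGroup.of i) : Set (FreeGroup (Fin 3)))) := by
  haveI : IsFreeGroup (⊤ : Subgroup (FreeGroup (Fin 3))) :=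
    IsFreeGroup.ofMulEquiv (Subgroup.topEquiv (G := FreeGroup (Fin 3))).symm
  rw [Literature.IUT.HodgeTheaters.ProfiniteCompletion.centralizer_toCompletion_eq_closure_of_isFreeGroup'
    (F := FreeGroup (Fin 3)) ⊤ inferInstance (g := FreeGroup.of i ^ m) (Subgroup.mem_top _),
    FreeGroup.centralizer_zpow_eq_zpowers (fun t k h => eq_one_of_pow_eq_of i t k h) hm]

/-! ### Slimness of the fibre product over `F̂₃` -/

variable (e êa êb : profiniteCompletion (FreeGroup (Fin 3)) →ₜ* profiniteCompletion (Multiplicative ℤ))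
  (îa îb : profiniteCompletion (Multiplicative ℤ) →ₜ* profiniteCompletion (FreeGroup (Fin 3)))
  (σ σa σb : FreeGroup (Fin 3) →* Multiplicative ℤ)
  (hσa : σ (FreeGroup.of 0) = 1) (hσb : σ (FreeGroup.of 1) = 1)
  (hσaa : σa (FreeGroup.of 0) = Multiplicative.ofAdd 1) (hσab : σa (FreeGroup.of 1) = 1)
  (hσba : σb (FreeGroup.of 0) = 1) (hσbb : σb (FreeGroup.of 1) = Multiplicative.ofAdd 1)
  (he : ∀ g, e (toCompletion _ g) = toCompletion _ (σ g))
  (hêa : ∀ g, êa (toCompletion _ g) = toCompletion _ (σa g))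
  (hêb : ∀ g, êb (toCompletion _ g) = toCompletion _ (σb g))
  (hîa : ∀ k : ℤ, îa (toCompletion _ (Multiplicative.ofAdd k)) = toCompletion _ (FreeGroup.of 0 ^ k))
  (hîb : ∀ k : ℤ, îb (toCompletion _ (Multiplicative.ofAdd k)) = toCompletion _ (FreeGroup.of 1 ^ k))
  (hιinj : Injective (toCompletion (Multiplicative ℤ)))
  (Γ : Subgroup (profiniteCompletion (FreeGroup (Fin 3)) × Multiplicative ℤ))
  (hΓ : ∀ p, p ∈ Γ ↔ e p.1 = toCompletion (Multiplicative ℤ) p.2)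

include hσa hσb hσaa hσab hσba hσbb he hêa hêb hîa hîb hιinj hΓ in
/-- **The tempered model group `Γ = F̂₃ ×_{Ẑ} ℤ` (fibre product for a character killing the first two
free generators) is slim**: every open subgroup `U ≤ Γ` has trivial centraliser ([SemiAnbd] Ex. 3.10
p. 45 "temp-slim", rank-three model: slices `(V × 0) ∩ Γ ⊆ U`, test elements `(η b^m, 0)`,
`(η(a b^m a⁻¹), 0)`, the centraliser condition in `F̂₃`, and the evaluations `êb`, `êa`, `e`).
[cite: MochizukiSemiAnbd2006, Ex 3.10 p.45] -/
theorem centralizer_eq_bot_of_isOpen₃ (U : Subgroup Γ) (hU : IsOpen (U : Set Γ)) :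
    Subgroup.centralizer (U : Set Γ) = ⊥ := by
  classical
  refine (Subgroup.eq_bot_iff_forall _).mpr fun q hq => ?_
  -- notation
  let a : FreeGroup (Fin 3) := FreeGroup.of 0
  let b : FreeGroup (Fin 3) := FreeGroup.of 1
  let η := toCompletion (FreeGroup (Fin 3))
  let ι := toCompletion (Multiplicative ℤ)
  -- a slice `N_V ⊆ U`
  obtain ⟨V, N, -, hN, hNU⟩ := exists_openNormal_le_of_mem_nhds Γ (hU.mem_nhds U.one_mem)
  haveI : V.toSubgroup.Normal := V.isNormal'
  -- `M := η⁻¹ V ⊴ F₃` of finite index `m`; `b^m ∈ M`, `a b^m a⁻¹ ∈ M`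
  let M : Subgroup (FreeGroup (Fin 3)) := V.toSubgroup.comap η
  haveI : M.Normal := Subgroup.Normal.comap inferInstance _
  haveI hVfi : V.toSubgroup.FiniteIndex := by
    haveI : Finite (profiniteCompletion (FreeGroup (Fin 3)) ⧸ V.toSubgroup) := inferInstance
    exact Subgroup.finiteIndex_of_finite_quotient
  have hMfi : M.FiniteIndex := by
    refine ⟨fun h0 => ?_⟩
    have hd := Subgroup.relIndex_dvd_index_of_normal V.toSubgroup η.range
    rw [← Subgroup.index_comap] at hd
    exact hVfi.index_ne_zero (Nat.eq_zero_of_zero_dvd (h0 ▸ hd))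
  let m : ℤ := M.index
  have hm : m ≠ 0 := by
    change (M.index : ℤ) ≠ 0
    exact_mod_cast hMfi.index_ne_zero
  have hbm : b ^ m ∈ M := by
    change b ^ ((M.index : ℕ) : ℤ) ∈ M
    rw [zpow_natCast]; exact M.pow_index_mem b
  have habm : a * b ^ m * a⁻¹ ∈ M := Subgroup.Normal.conj_mem inferInstance _ hbm a
  have hσbm : σ (b ^ m) = 1 := by rw [map_zpow, hσb, one_zpow]
  have hσabm : σ (a * b ^ m * a⁻¹) = 1 := by
    rw [map_mul, map_mul, map_inv, hσbm, mul_one, hσa, inv_one, mul_one]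
  -- the two test elements of `U`
  have hw₁Γ : ((η (b ^ m), (1 : Multiplicative ℤ)) : _ × Multiplicative ℤ) ∈ Γ := by
    rw [hΓ]; change e (η (b ^ m)) = ι 1; rw [he, hσbm]
  have hw₂Γ : ((η (a * b ^ m * a⁻¹), (1 : Multiplicative ℤ)) : _ × Multiplicative ℤ) ∈ Γ := by
    rw [hΓ]; change e (η (a * b ^ m * a⁻¹)) = ι 1; rw [he, hσabm]
  have hw₁U : (⟨_, hw₁Γ⟩ : Γ) ∈ U := hNU ((hN _).mpr ⟨hbm, rfl⟩)
  have hw₂U : (⟨_, hw₂Γ⟩ : Γ) ∈ U := hNU ((hN _).mpr ⟨habm, rfl⟩)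
  -- `q = (z, n)` commutes with both
  obtain ⟨⟨z, n⟩, hzn⟩ := q
  have hc₁ : η (b ^ m) * z = z * η (b ^ m) := by
    have := Subgroup.mem_centralizer_iff.mp hq _ hw₁U
    exact congrArg (fun r : Γ => (r : profiniteCompletion (FreeGroup (Fin 3)) × Multiplicative ℤ).1) this
  have hc₂ : η (a * b ^ m * a⁻¹) * z = z * η (a * b ^ m * a⁻¹) := by
    have := Subgroup.mem_centralizer_iff.mp hq _ hw₂U
    exact congrArg (fun r : Γ => (r : profiniteCompletion (FreeGroup (Fin 3)) × Multiplicative ℤ).1) this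
  -- hence `z ∈ cl η⟨b⟩ ⊆ range îb` and `(η a)⁻¹ z (η a) ∈ cl η⟨b⟩ ⊆ range îb`
  have hB : ∀ y : profiniteCompletion (FreeGroup (Fin 3)), η (b ^ m) * y = y * η (b ^ m) →
      ∃ t, îb t = y := by
    intro y hy
    have hy' : y ∈ Subgroup.centralizer
        ({η (b ^ m)} : Set (profiniteCompletion (FreeGroup (Fin 3)))) :=
      Subgroup.mem_centralizer_singleton_iff.mpr hy.symm
    exact closure_eta_zpowers_subset_range b îb hîb (centralizer_eta_of_zpow_subset₃ 1 hm hy')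
  obtain ⟨t, ht⟩ := hB z hc₁
  have hc₂' : η (b ^ m) * ((η a)⁻¹ * z * η a) = ((η a)⁻¹ * z * η a) * η (b ^ m) := by
    rw [map_mul, map_mul, map_inv] at hc₂
    have h3 := congrArg (fun w => (η a)⁻¹ * w * η a) hc₂
    calc η (b ^ m) * ((η a)⁻¹ * z * η a)
        = (η a)⁻¹ * (η a * η (b ^ m) * (η a)⁻¹ * z) * η a := by
          simp only [mul_assoc, inv_mul_cancel_left]
      _ = (η a)⁻¹ * (z * (η a * η (b ^ m) * (η a)⁻¹)) * η a := by rw [h3]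
      _ = ((η a)⁻¹ * z * η a) * η (b ^ m) := by
          simp only [mul_assoc, inv_mul_cancel, mul_one]
  obtain ⟨t', ht'⟩ := hB _ hc₂'
  -- evaluate `êb`: `êb (η a) = 1`, `êb ∘ îb = id` ⇒ `t = t'` ⇒ `z` commutes with `η a`
  have hêba : êb (η a) = 1 := by rw [hêb, hσba]; exact map_one _
  have ht_eq : t = t' := by
    have h1 : êb z = t := by rw [← ht]; exact apply_apply_eq_self_of b σb hσbb êb îb hêb hîb t
    have h2 : êb ((η a)⁻¹ * z * η a) = t' := by
      rw [← ht']; exact apply_apply_eq_self_of b σb hσbb êb îb hêb hîb t'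
    rw [map_mul, map_mul, map_inv, hêba, inv_one, one_mul, mul_one, h1] at h2
    exact h2
  have hza : η a * z = z * η a := by
    have h4 : (η a)⁻¹ * z * η a = z := by rw [← ht', ← ht_eq, ht]
    calc η a * z = η a * ((η a)⁻¹ * z * η a) := by rw [h4]
      _ = z * η a := by simp only [mul_assoc, mul_inv_cancel_left]
  -- `z ∈ C(η a) = cl η⟨a⟩ ⊆ range îa`
  have hA : ∃ u, îa u = z := by
    have hz' : z ∈ Subgroup.centralizer
        ({η (a ^ (1 : ℤ))} : Set (profiniteCompletion (FreeGroup (Fin 3)))) := by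
      rw [zpow_one]; exact Subgroup.mem_centralizer_singleton_iff.mpr hza.symm
    exact closure_eta_zpowers_subset_range a îa hîa
      (centralizer_eta_of_zpow_subset₃ 0 one_ne_zero hz')
  obtain ⟨u, hu⟩ := hA
  -- evaluate `êa`: `êa ∘ îa = id`, `êa ∘ îb = 1` ⇒ `u = 1` ⇒ `z = 1`
  have hu1 : u = 1 := by
    have h1 : êa z = u := by rw [← hu]; exact apply_apply_eq_self_of a σa hσaa êa îa hêa hîa u
    have h2 : êa z = 1 := by rw [← ht]; exact apply_apply_eq_one_of b σa hσab êa îb hêa hîb t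
    rw [h1] at h2; exact h2
  have hz1 : z = 1 := by rw [← hu, hu1, map_one]
  -- and `n = 0`
  have hn1 : n = 1 := by
    have h := (hΓ _).mp hzn
    change e z = ι n at h
    rw [hz1, map_one] at h
    exact hιinj (by rw [map_one]; exact h.symm)
  subst hz1; subst hn1
  rfl

end TemperedFibreProduct

end Literature.AnabelianGeometry.SemiGraphs

end
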